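import Literature.AlgebraicGeometry.Resolution.BlowupOffCentre
import Literature.AlgebraicGeometry.Resolution.HasSNCWithOffCentre
import Literature.AlgebraicGeometry.Resolution.BlowupsProduct
import HarnessLib

/-!
# Transforms along a composite of two blow-ups with DISJOINT centres (re-sequencing a reducible regular centre)

Topic: `Literature/AlgebraicGeometry/Resolution`. Kernel support («F4a») for the irreducible refinement of blow-up
sequences (BGMW 2011, §4 Step 2b "we can randomly pick any maximal irreducible component"; Stacks 080A: blowing up in a
product of ideals = blowing up one factor after the other, tree `IsBlowup.comp`, `BlowupsProduct.lean`). Setting: a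
blow-up `p : Y → X` along `C₁`, a blow-up `p″ : W → Y` along the pulled-back second centre `p^*C₂`, where the two
centres are DISJOINT, `V(C₁) ∩ V(C₂) = ∅`; the composite `q = p″ ≫ p` is a blow-up of `X` along `C₁·C₂` (Stacks 080A).
We compare the ONE-STEP transforms along `q` with centre `C₁·C₂` and the TWO-STEP (iterated) transforms:

* `IsBlowup.controlledTransform_comp_of_disjoint` — `qᶜ(𝓘, μ)` (centre `C₁·C₂`) `= p″ᶜ(pᶜ(𝓘, μ), μ)` (stalkwise:
  over `V(C₁)` the second exceptional factor is a unit and `p″` is a local isomorphism; over `X ∖ V(C₁)` the first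
  exceptional factor is a unit and `pᶜ = p^*`);
* `IsBlowup.strictTransformIdeal_comp_of_disjoint` — the same for the strict transforms of boundary divisors;
* `IsBlowup.strictTransformIdeal_comap_fst_of_disjoint` — the first exceptional divisor `p^*C₁`, disjoint from the
  second centre, has strict transform `p″^*p^*C₁`;
* `IsBlowup.transform_comp_of_disjoint_ideal` / `_mult` and `IsBlowup.boundaryEquiv_transform_comp_of_disjoint` — for a
  marked ideal `M = (X, 𝓘, E, μ)` whose boundary has simple normal crossings with both centres: the one-step transform
  `M.transform q (C₁C₂)` and the two-step transform `(M.transform p C₁).transform p″ (p^*C₂)` have the SAME ideal and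
  multiplicity and pointwise EQUIVALENT boundaries (`BoundaryEquiv`, BGMW Def. 3.1.1: the single exceptional divisor of
  the former splits as the two disjoint exceptional divisors of the latter); hence they have the same resolutions
  (`IsBlowup.isResolutionOf_transform_comp_iff_of_disjoint`, via `CentreSeq.IsResolutionOf.of_boundaryEquiv`).

Standard facts over the tree's carriers (BGMW Def. 3.1.3 (3)–(5), §3.2); written for the HIRONAKA-L lane (cell
res-hironaka, LIB «irreducible refinement of CentreSeq resolutions», res-D-plan-1 ROUTING #7 (u)) by res-D-pv-052.

## References
* The Stacks Project, Tag 080A (blowing up a product of ideals). [StacksProject]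
* E. Bierstone, D. Grigoriev, P. Milman, J. Włodarczyk, *Effective Hironaka resolution and its complexity*, Asian J.
  Math. 15 (2011), arXiv:1206.3090, Def. 3.1.1, Def. 3.1.3, §3.2, §4 Step 2b. [BierstoneGrigorievMilmanWlodarczyk2011]
-/

noncomputable section

open CategoryTheory AlgebraicGeometry TopologicalSpace IsLocalRing

namespace Literature.AlgebraicGeometry.Resolution

universe u

/-! ## Colon ideals under bijective ring maps; ideal sheaves from stalks -/

/-- A bijective ring map carries a colon ideal onto the colon ideal of the images. [folklore] -/
private theorem map_colon_of_bijective {R S : Type*} [CommRing R] [CommRing S] (f : R →+* S)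
    (hf : Function.Bijective f) (I J : Ideal R) :
    (Submodule.colon I (J : Set R)).map f = Submodule.colon (I.map f) (J.map f : Set S) := by
  ext y
  constructor
  · intro hy
    obtain ⟨x, hx, rfl⟩ := (Ideal.mem_map_iff_of_surjective f hf.2).mp hy
    refine Submodule.mem_colon.mpr fun s hs => ?_
    obtain ⟨j, hj, rfl⟩ := (Ideal.mem_map_iff_of_surjective f hf.2).mp hs
    rw [smul_eq_mul, ← map_mul]
    exact Ideal.mem_map_of_mem f (by simpa [smul_eq_mul] using Submodule.mem_colon.mp hx j hj)
  · intro hy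
    obtain ⟨x, rfl⟩ := hf.2 y
    refine Ideal.mem_map_of_mem f (Submodule.mem_colon.mpr fun j hj => ?_)
    have h1 : f x * f j ∈ I.map f := by
      simpa [smul_eq_mul] using Submodule.mem_colon.mp hy (f j) (Ideal.mem_map_of_mem f hj)
    rw [← map_mul] at h1
    obtain ⟨i, hi, hfi⟩ := (Ideal.mem_map_iff_of_surjective f hf.2).mp h1
    rw [smul_eq_mul, ← hf.1 hfi]
    exact hi

/-- Ideal sheaves with equal stalks are equal. [folklore] -/
private theorem eq_of_forall_stalkIdeal_eq {X : Scheme.{u}} {I J : X.IdealSheafData}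
    (h : ∀ x : X, stalkIdeal I x = stalkIdeal J x) : I = J :=
  le_antisymm (le_of_forall_stalkIdeal_le fun x => (h x).le) (le_of_forall_stalkIdeal_le fun x => (h x).ge)

/-- Membership in the support of a pull-back. [folklore] -/
private theorem mem_support_comap_iff {X Y : Scheme.{u}} (f : Y ⟶ X) (K : X.IdealSheafData) (y : Y) :
    y ∈ (K.comap f).support ↔ f y ∈ K.support := by
  rw [Scheme.IdealSheafData.support_comap]
  rfl

/-- The colon by the unit ideal is the ideal itself. [folklore] -/
private theorem colon_top_eq {R : Type*} [CommRing R] (N : Ideal R) :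
    Submodule.colon N ((⊤ : Ideal R) : Set R) = N := by
  ext z
  rw [Submodule.mem_colon]
  constructor
  · intro h
    simpa using h 1 trivial
  · intro hz s _
    rw [smul_eq_mul]
    exact Ideal.mul_mem_right s N hz

/-! ## The setting: two blow-ups with disjoint centres -/

section TwoSteps

variable {X Y W : Scheme.{u}} {p : Y ⟶ X} {p'' : W ⟶ Y} {C₁ C₂ : X.IdealSheafData}

/-- `q^*(C₁·C₂) = p″^*p^*C₁ · p″^*p^*C₂` for `q = p″ ≫ p` (pull-back of ideal sheaves is functorial and
multiplicative). [cite: StacksProject, Tag 080A] -/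
theorem comap_mul_comp (C₁ C₂ : X.IdealSheafData) (p : Y ⟶ X) (p'' : W ⟶ Y) :
    (C₁ * C₂).comap (p'' ≫ p) = (C₁.comap p).comap p'' * (C₂.comap p).comap p'' := by
  rw [comap_mul, Scheme.IdealSheafData.comap_comp, Scheme.IdealSheafData.comap_comp]

/-- Stalks of a pull-back along the second map: `(p″^*K)_w = p″_w(K_{p″ w})`. [folklore] -/
private theorem stalkIdeal_comap_snd (K : Y.IdealSheafData) (w : W) :
    stalkIdeal (K.comap p'') w = (stalkIdeal K (p'' w)).map (p''.stalkMap w).hom :=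
  stalkIdeal_comap_eq_map_stalkMap p'' K w

/-- Off a closed set downstairs, the twice pulled-back stalk is the unit ideal. [folklore] -/
private theorem stalkIdeal_comap_comap_eq_top {K : X.IdealSheafData} {w : W}
    (hx : p (p'' w) ∉ (K.support : Set X)) : stalkIdeal ((K.comap p).comap p'') w = ⊤ := by
  apply stalkIdeal_eq_top_of_not_mem_support
  rw [mem_support_comap_iff, mem_support_comap_iff]
  exact fun h => hx h

/-- Over the first centre the second blow-up has bijective stalk maps (it is an isomorphism there).
[cite: StacksProject, Tag 02OS] -/
private theorem bijective_stalkMap_snd (hp'' : IsBlowup p'' (C₂.comap p))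
    (hdisj : Disjoint (C₁.support : Set X) (C₂.support : Set X)) {w : W} (hx : p (p'' w) ∈ (C₁.support : Set X)) :
    Function.Bijective (p''.stalkMap w).hom := by
  have hx2 : p (p'' w) ∉ (C₂.support : Set X) := fun h => hdisj.le_bot ⟨hx, h⟩
  have hy2 : p'' w ∉ (C₂.comap p).support := by rw [mem_support_comap_iff]; exact fun h => hx2 h
  haveI := hp''.isIso_stalkMap_of_not_mem_support hy2
  exact (asIso (p''.stalkMap w)).commRingCatIsoToRingEquiv.bijective

variable (hp : IsBlowup p C₁) (hp'' : IsBlowup p'' (C₂.comap p))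
  (hdisj : Disjoint (C₁.support : Set X) (C₂.support : Set X))
include hp hp'' hdisj

/-- **Controlled transforms along the composite = iterated controlled transforms** (disjoint centres), stalkwise.
[cite: BierstoneGrigorievMilmanWlodarczyk2011, §3.2 with Def. 3.1.3 (3)] -/
private theorem stalkIdeal_controlledTransform_comp [IsLocallyNoetherian Y] [IsLocallyNoetherian W]
    (I : X.IdealSheafData) (μ : ℕ) (w : W) :
    stalkIdeal (controlledTransform (p'' ≫ p) (C₁ * C₂) I μ) w =
      stalkIdeal (controlledTransform p'' (C₂.comap p) (controlledTransform p C₁ I μ) μ) w := by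
  have hq : IsBlowup (p'' ≫ p) (C₁ * C₂) := hp.comp hp''
  set J := controlledTransform p C₁ I μ with hJ
  have hIq : stalkIdeal (I.comap (p'' ≫ p)) w = (stalkIdeal (I.comap p) (p'' w)).map (p''.stalkMap w).hom := by
    rw [Scheme.IdealSheafData.comap_comp, stalkIdeal_comap_snd]
  have hC1q : stalkIdeal ((C₁.comap p).comap p'') w = (stalkIdeal (C₁.comap p) (p'' w)).map (p''.stalkMap w).hom :=
    stalkIdeal_comap_snd _ w
  rw [hq.stalkIdeal_controlledTransform, comap_mul_comp, stalkIdeal_mul, hp''.stalkIdeal_controlledTransform J μ w,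
    stalkIdeal_comap_snd J w]
  by_cases hx : p (p'' w) ∈ (C₁.support : Set X)
  · -- over the first centre: `q^*C₂` is a unit at `w`, `p″` is a local isomorphism
    have hx2 : p (p'' w) ∉ (C₂.support : Set X) := fun h => hdisj.le_bot ⟨hx, h⟩
    have h2 : stalkIdeal ((C₂.comap p).comap p'') w = ⊤ := stalkIdeal_comap_comap_eq_top hx2
    rw [h2, Ideal.mul_top, Ideal.top_pow, colon_top_eq, hJ, hp.stalkIdeal_controlledTransform I μ (p'' w),
      map_colon_of_bijective _ (bijective_stalkMap_snd hp'' hdisj hx), Ideal.map_pow, ← hIq, ← hC1q]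
  · -- off the first centre: `q^*C₁` is a unit at `w` and `pᶜ(𝓘, μ) = p^*𝓘` at `p″ w`
    have h1 : stalkIdeal ((C₁.comap p).comap p'') w = ⊤ := stalkIdeal_comap_comap_eq_top hx
    rw [h1, Ideal.top_mul, hJ, hp.stalkIdeal_controlledTransform_of_not_mem I μ hx, ← hIq]

/-- **Controlled transforms along the composite = iterated controlled transforms** (disjoint centres):
`qᶜ(𝓘, μ)` with centre `C₁·C₂` equals `p″ᶜ(pᶜ(𝓘, μ), μ)` with centres `C₁` then `p^*C₂`.
[cite: BierstoneGrigorievMilmanWlodarczyk2011, §3.2 with Def. 3.1.3 (3)] -/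
theorem IsBlowup.controlledTransform_comp_of_disjoint [IsLocallyNoetherian Y] [IsLocallyNoetherian W]
    (I : X.IdealSheafData) (μ : ℕ) :
    controlledTransform (p'' ≫ p) (C₁ * C₂) I μ =
      controlledTransform p'' (C₂.comap p) (controlledTransform p C₁ I μ) μ :=
  eq_of_forall_stalkIdeal_eq fun w => stalkIdeal_controlledTransform_comp hp hp'' hdisj I μ w

omit hp in
/-- **Strict transforms along the composite = iterated strict transforms** (disjoint centres), stalkwise.
[cite: BierstoneGrigorievMilmanWlodarczyk2011, §3.2 with Def. 3.1.3 (4)] -/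
private theorem stalkIdeal_strictTransformIdeal_comp [IsLocallyNoetherian Y] [IsLocallyNoetherian W]
    (K : X.IdealSheafData) (w : W) :
    stalkIdeal (strictTransformIdeal (p'' ≫ p) (C₁ * C₂) K) w =
      stalkIdeal (strictTransformIdeal p'' (C₂.comap p) (strictTransformIdeal p C₁ K)) w := by
  have hKq : ((stalkIdeal K ((p'' ≫ p) w)).map ((p'' ≫ p).stalkMap w).hom) =
      ((stalkIdeal (K.comap p) (p'' w)).map (p''.stalkMap w).hom) := by
    rw [← stalkIdeal_comap_eq_map_stalkMap, Scheme.IdealSheafData.comap_comp, stalkIdeal_comap_snd]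
  have hKp : stalkIdeal (K.comap p) (p'' w) = (stalkIdeal K (p (p'' w))).map (p.stalkMap (p'' w)).hom :=
    stalkIdeal_comap_eq_map_stalkMap p K (p'' w)
  have hC1q : stalkIdeal ((C₁.comap p).comap p'') w = (stalkIdeal (C₁.comap p) (p'' w)).map (p''.stalkMap w).hom :=
    stalkIdeal_comap_snd _ w
  rw [stalkIdeal_strictTransformIdeal (p'' ≫ p) (C₁ * C₂) K w, comap_mul_comp, stalkIdeal_mul, hKq,
    stalkIdeal_strictTransformIdeal p'' (C₂.comap p) _ w, stalkIdeal_strictTransformIdeal p C₁ K (p'' w)]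
  by_cases hx : p (p'' w) ∈ (C₁.support : Set X)
  · -- over the first centre
    have hx2 : p (p'' w) ∉ (C₂.support : Set X) := fun h => hdisj.le_bot ⟨hx, h⟩
    have h2 : stalkIdeal ((C₂.comap p).comap p'') w = ⊤ := stalkIdeal_comap_comap_eq_top hx2
    rw [h2, Ideal.mul_top]
    simp only [Ideal.top_pow, colon_top_eq, ciSup_const]
    rw [Ideal.map_iSup]
    refine iSup_congr fun n => ?_
    rw [map_colon_of_bijective _ (bijective_stalkMap_snd hp'' hdisj hx), Ideal.map_pow, ← hKp, ← hC1q]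
  · -- off the first centre
    have h1 : stalkIdeal ((C₁.comap p).comap p'') w = ⊤ := stalkIdeal_comap_comap_eq_top hx
    have h1' : stalkIdeal (C₁.comap p) (p'' w) = ⊤ :=
      stalkIdeal_eq_top_of_not_mem_support (by rw [mem_support_comap_iff]; exact fun h => hx h)
    rw [h1, Ideal.top_mul, h1']
    simp only [Ideal.top_pow, colon_top_eq, ciSup_const]
    rw [← hKp]

omit hp in
/-- **Strict transforms along the composite = iterated strict transforms** (disjoint centres; only the second map
needs to be a blow-up). [cite: BierstoneGrigorievMilmanWlodarczyk2011, §3.2 with Def. 3.1.3 (4)] -/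
theorem IsBlowup.strictTransformIdeal_comp_of_disjoint [IsLocallyNoetherian Y] [IsLocallyNoetherian W]
    (K : X.IdealSheafData) :
    strictTransformIdeal (p'' ≫ p) (C₁ * C₂) K =
      strictTransformIdeal p'' (C₂.comap p) (strictTransformIdeal p C₁ K) :=
  eq_of_forall_stalkIdeal_eq fun w => stalkIdeal_strictTransformIdeal_comp hp'' hdisj K w

omit hp in
/-- **The first exceptional divisor is untouched by the second blow-up**: `p^*C₁` misses the second centre `p^*C₂`,
so its strict transform under `p″` is its total transform `p″^*p^*C₁`. [cite: GortzWedhorn2020, (13.19) p. 414] -/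
theorem IsBlowup.strictTransformIdeal_comap_fst_of_disjoint [IsLocallyNoetherian Y] [IsLocallyNoetherian W] :
    strictTransformIdeal p'' (C₂.comap p) (C₁.comap p) = (C₁.comap p).comap p'' := by
  refine eq_of_forall_stalkIdeal_eq fun w => ?_
  by_cases hx2 : p (p'' w) ∈ (C₂.support : Set X)
  · -- over the second centre both are the unit ideal
    have hx1 : p (p'' w) ∉ (C₁.support : Set X) := fun h => hdisj.le_bot ⟨h, hx2⟩
    have h1' : stalkIdeal (C₁.comap p) (p'' w) = ⊤ :=
      stalkIdeal_eq_top_of_not_mem_support (by rw [mem_support_comap_iff]; exact fun h => hx1 h)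
    rw [stalkIdeal_comap_comap_eq_top hx1, stalkIdeal_strictTransformIdeal p'' (C₂.comap p) _ w, h1',
      Ideal.map_top]
    -- `⨆ₙ (⊤ : Dⁿ) = ⊤`
    refine top_le_iff.mp (le_iSup_of_le 0 ?_)
    intro z _
    exact Submodule.mem_colon.mpr fun s _ => Submodule.mem_top
  · have hy2 : p'' w ∉ ((C₂.comap p).support : Set Y) := by
      rw [SetLike.mem_coe, mem_support_comap_iff]; exact fun h => hx2 h
    exact hp''.stalkIdeal_strictTransformIdeal_of_not_mem _ hy2

/-! ## The marked transforms: same ideal, same multiplicity, equivalent boundaries -/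

omit hp hp'' hdisj in
/-- **Splitting one boundary divisor into two disjoint ones is a boundary equivalence**: for `D₁`, `D₂` with disjoint
supports, `L ++ [D₁·D₂]` and `L ++ [D₁, D₂]` have, through every point, the same divisors with the same stalks (at most
one of `D₁`, `D₂` passes through a point, and there `(D₁D₂)_x` is its stalk), provided both lists are stalk-injective.
[cite: BierstoneGrigorievMilmanWlodarczyk2011, Def. 3.1.1] -/
theorem boundaryEquiv_append_mul_of_disjoint {Z : Scheme.{u}} (L : List Z.IdealSheafData) (D₁ D₂ : Z.IdealSheafData)
    (hD : Disjoint (D₁.support : Set Z) (D₂.support : Set Z)) (hinj₁ : ∀ z, StalkInjectiveAt (L ++ [D₁ * D₂]) z)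
    (hinj₂ : ∀ z, StalkInjectiveAt (L ++ [D₁, D₂]) z) : BoundaryEquiv (L ++ [D₁ * D₂]) (L ++ [D₁, D₂]) := by
  intro z
  have hst1 : z ∉ (D₂.support : Set Z) → stalkIdeal (D₁ * D₂) z = stalkIdeal D₁ z := fun h => by
    rw [stalkIdeal_mul, stalkIdeal_eq_top_of_not_mem_support (fun h' => h h'), Ideal.mul_top]
  have hst2 : z ∉ (D₁.support : Set Z) → stalkIdeal (D₁ * D₂) z = stalkIdeal D₂ z := fun h => by
    rw [stalkIdeal_mul, stalkIdeal_eq_top_of_not_mem_support (fun h' => h h'), Ideal.top_mul]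
  refine ⟨fun D hD' hz => ?_, fun D hD' hz => ?_, hinj₁ z, hinj₂ z⟩
  · rcases List.mem_append.mp hD' with hL | hE
    · exact ⟨D, List.mem_append.mpr (Or.inl hL), hz, rfl⟩
    · rw [List.mem_singleton] at hE
      subst hE
      have hz' : z ∈ (D₁.support : Set Z) ∪ (D₂.support : Set Z) := by
        have : z ∈ ((D₁ * D₂).support : Set Z) := hz
        rwa [Scheme.IdealSheafData.support_mul, Closeds.coe_sup] at this
      rcases hz' with h1 | h2
      · exact ⟨D₁, List.mem_append.mpr (Or.inr (by simp)), h1, (hst1 fun h2 => hD.le_bot ⟨h1, h2⟩).symm⟩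
      · exact ⟨D₂, List.mem_append.mpr (Or.inr (by simp)), h2, (hst2 fun h1 => hD.le_bot ⟨h1, h2⟩).symm⟩
  · rcases List.mem_append.mp hD' with hL | hE
    · exact ⟨D, List.mem_append.mpr (Or.inl hL), hz, rfl⟩
    · have hmul : ∀ {D' : Z.IdealSheafData}, z ∈ (D'.support : Set Z) →
          (D'.support : Set Z) ⊆ ((D₁ * D₂).support : Set Z) → z ∈ ((D₁ * D₂).support : Set Z) :=
        fun h h' => h' h
      have hsub1 : (D₁.support : Set Z) ⊆ ((D₁ * D₂).support : Set Z) := by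
        rw [Scheme.IdealSheafData.support_mul, Closeds.coe_sup]; exact Set.subset_union_left
      have hsub2 : (D₂.support : Set Z) ⊆ ((D₁ * D₂).support : Set Z) := by
        rw [Scheme.IdealSheafData.support_mul, Closeds.coe_sup]; exact Set.subset_union_right
      rcases List.mem_pair.mp hE with h | h <;> rw [h] at hz ⊢
      · exact ⟨D₁ * D₂, List.mem_append.mpr (Or.inr (List.mem_singleton.mpr rfl)), hmul hz hsub1,
          hst1 fun h2 => hD.le_bot ⟨hz, h2⟩⟩
      · exact ⟨D₁ * D₂, List.mem_append.mpr (Or.inr (List.mem_singleton.mpr rfl)), hmul hz hsub2,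
          hst2 fun h1 => hD.le_bot ⟨h1, hz⟩⟩

/-- **The two transforms have the same ideal.** [cite: BierstoneGrigorievMilmanWlodarczyk2011, Def. 3.1.3 (3)] -/
theorem IsBlowup.transform_comp_of_disjoint_ideal [IsLocallyNoetherian Y] [IsLocallyNoetherian W]
    (M : MarkedIdeal X) :
    (M.transform (p'' ≫ p) (C₁ * C₂)).ideal = ((M.transform p C₁).transform p'' (C₂.comap p)).ideal := by
  simp only [MarkedIdeal.transform_ideal, MarkedIdeal.transform_mult]
  exact hp.controlledTransform_comp_of_disjoint hp'' hdisj M.ideal M.mult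

omit hp hp'' hdisj in
/-- **The two transforms have the same multiplicity.** [cite: BierstoneGrigorievMilmanWlodarczyk2011, Def. 3.1.3 (3)] -/
theorem IsBlowup.transform_comp_of_disjoint_mult (M : MarkedIdeal X) :
    (M.transform (p'' ≫ p) (C₁ * C₂)).mult = ((M.transform p C₁).transform p'' (C₂.comap p)).mult := rfl

omit hp in
/-- **The boundary of the two-step transform, rewritten**: it is the one-step strict transforms of the old boundary
followed by the two (disjoint) exceptional divisors `p″^*p^*C₁`, `p″^*p^*C₂`.
[cite: BierstoneGrigorievMilmanWlodarczyk2011, Def. 3.1.3 (4)–(5)] -/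
theorem IsBlowup.transform_transform_boundary_eq [IsLocallyNoetherian Y] [IsLocallyNoetherian W]
    (M : MarkedIdeal X) :
    ((M.transform p C₁).transform p'' (C₂.comap p)).boundary =
      M.boundary.map (strictTransformIdeal (p'' ≫ p) (C₁ * C₂)) ++
        [(C₁.comap p).comap p'', (C₂.comap p).comap p''] := by
  have hfun : (strictTransformIdeal p'' (C₂.comap p)) ∘ (strictTransformIdeal p C₁) =
      strictTransformIdeal (p'' ≫ p) (C₁ * C₂) := by
    funext K
    exact (hp''.strictTransformIdeal_comp_of_disjoint hdisj K).symm
  simp only [MarkedIdeal.transform_boundary, List.map_append, List.map_map, List.map_cons, List.map_nil,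
    List.append_assoc, hfun, hp''.strictTransformIdeal_comap_fst_of_disjoint hdisj]
  rfl

omit hp hp'' in
/-- **Simple normal crossings with two disjoint centres give simple normal crossings with their product** (the
reducible centre `V(C₁) ⊔ V(C₂)`): at each point at most one of the centres is present.
[cite: BierstoneGrigorievMilmanWlodarczyk2011, Def. 3.1.3 (2)] -/
theorem HasSNCWith.mul_of_disjoint {E : List X.IdealSheafData} (h₁ : HasSNCWith E C₁) (h₂ : HasSNCWith E C₂) :
    HasSNCWith E (C₁ * C₂) := by
  intro x
  by_cases hx1 : x ∈ (C₁.support : Set X)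
  · have hx2 : x ∉ C₂.support := fun h => hdisj.le_bot ⟨hx1, h⟩
    obtain ⟨hreg, u, hu, hE, hC⟩ := h₁ x
    refine ⟨hreg, u, hu, hE, fun _ => ?_⟩
    obtain ⟨S, hS⟩ := hC hx1
    exact ⟨S, by rw [stalkIdeal_mul, stalkIdeal_eq_top_of_not_mem_support hx2, Ideal.mul_top, hS]⟩
  · obtain ⟨hreg, u, hu, hE, hC⟩ := h₂ x
    refine ⟨hreg, u, hu, hE, fun hx => ?_⟩
    have hx2 : x ∈ C₂.support := by
      have hx' : x ∈ ((C₁ * C₂).support : Set X) := hx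
      rw [Scheme.IdealSheafData.support_mul, Closeds.coe_sup] at hx'
      exact hx'.resolve_left hx1
    obtain ⟨S, hS⟩ := hC hx2
    exact ⟨S, by rw [stalkIdeal_mul, stalkIdeal_eq_top_of_not_mem_support (fun h => hx1 h), Ideal.top_mul, hS]⟩

omit hp hp'' hdisj in
/-- **The boundary of the one-step transform, rewritten** with the exceptional divisor split as a product.
[cite: BierstoneGrigorievMilmanWlodarczyk2011, Def. 3.1.3 (4)–(5)] -/
theorem IsBlowup.transform_comp_boundary_eq (M : MarkedIdeal X) :
    (M.transform (p'' ≫ p) (C₁ * C₂)).boundary =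
      M.boundary.map (strictTransformIdeal (p'' ≫ p) (C₁ * C₂)) ++
        [(C₁.comap p).comap p'' * (C₂.comap p).comap p''] := by
  rw [MarkedIdeal.transform_boundary, comap_mul_comp]

/-- **The two transforms have equivalent boundaries** (BGMW Def. 3.1.1): the single exceptional divisor
`q⁻¹(V(C₁) ⊔ V(C₂))` of the one-step transform splits as the two disjoint exceptional divisors of the two-step one,
the strict transforms of the old boundary agree. Hypotheses: the old boundary has simple normal crossings with both
centres (for the stalk-injectivity of the transformed boundaries).
[cite: BierstoneGrigorievMilmanWlodarczyk2011, Def. 3.1.1, Def. 3.1.3 (2), (4), (5)] -/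
theorem IsBlowup.boundaryEquiv_transform_comp_of_disjoint [IsLocallyNoetherian X] [IsLocallyNoetherian Y]
    [IsLocallyNoetherian W] (M : MarkedIdeal X) (h₁ : HasSNCWith M.boundary C₁) (h₂ : HasSNCWith M.boundary C₂) :
    BoundaryEquiv (M.transform (p'' ≫ p) (C₁ * C₂)).boundary
      ((M.transform p C₁).transform p'' (C₂.comap p)).boundary := by
  have hq : IsBlowup (p'' ≫ p) (C₁ * C₂) := hp.comp hp''
  -- stalk-injectivity of both transformed boundaries, from their simple normal crossings
  have hs1 : HasSNC (M.transform (p'' ≫ p) (C₁ * C₂)).boundary := by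
    rw [MarkedIdeal.transform_boundary]
    exact (HasSNCWith.mul_of_disjoint hdisj h₁ h₂).hasSNC_transform hq
  have hs2 : HasSNC ((M.transform p C₁).transform p'' (C₂.comap p)).boundary := by
    rw [MarkedIdeal.transform_boundary, MarkedIdeal.transform_boundary]
    exact (h₁.transform_comap_of_disjoint hp h₂ hdisj).hasSNC_transform hp''
  rw [IsBlowup.transform_comp_boundary_eq] at hs1 ⊢
  rw [hp''.transform_transform_boundary_eq hdisj M] at hs2 ⊢
  refine boundaryEquiv_append_mul_of_disjoint _ _ _ ?_ (fun z => hs1.injOn_stalkIdeal z)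
    (fun z => hs2.injOn_stalkIdeal z)
  rw [Set.disjoint_left]
  intro w hw1 hw2
  have hw1' : p (p'' w) ∈ (C₁.support : Set X) :=
    (mem_support_comap_iff p C₁ _).mp ((mem_support_comap_iff p'' _ w).mp hw1)
  have hw2' : p (p'' w) ∈ (C₂.support : Set X) :=
    (mem_support_comap_iff p C₂ _).mp ((mem_support_comap_iff p'' _ w).mp hw2)
  exact hdisj.le_bot ⟨hw1', hw2'⟩

omit hp hp'' hdisj in
/-- Marked ideals with the same ideal, the same multiplicity and equivalent boundaries have the same resolutions.
[cite: BierstoneGrigorievMilmanWlodarczyk2011, Def. 3.1.1] -/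
private theorem isResolutionOf_iff_of_boundaryEquiv {Z : Scheme.{u}} [IsLocallyNoetherian Z] (s : CentreSeq Z) :
    ∀ (N₁ N₂ : MarkedIdeal Z), N₁.ideal = N₂.ideal → N₁.mult = N₂.mult → BoundaryEquiv N₁.boundary N₂.boundary →
      (s.IsResolutionOf N₁ ↔ s.IsResolutionOf N₂) := by
  rintro ⟨I₁, B₁, μ₁⟩ ⟨I₂, B₂, μ₂⟩ hI hμ hB
  simp only at hI hμ hB
  subst hI hμ
  exact ⟨CentreSeq.IsResolutionOf.of_boundaryEquiv s hB, CentreSeq.IsResolutionOf.of_boundaryEquiv s hB.symm⟩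

/-- **Re-sequencing does not change resolutions**: a blow-up sequence on `W` resolves the one-step transform
`M.transform q (C₁·C₂)` iff it resolves the two-step transform `(M.transform p C₁).transform p″ (p^*C₂)`
(same ideal and multiplicity, equivalent boundaries; BGMW Def. 3.1.1/3.1.3).
[cite: BierstoneGrigorievMilmanWlodarczyk2011, Def. 3.1.1, Def. 3.1.3; §4 Step 2b] -/
theorem IsBlowup.isResolutionOf_transform_comp_iff_of_disjoint [IsLocallyNoetherian X] [IsLocallyNoetherian Y]
    [IsLocallyNoetherian W] (s : CentreSeq W) (M : MarkedIdeal X) (h₁ : HasSNCWith M.boundary C₁)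
    (h₂ : HasSNCWith M.boundary C₂) :
    s.IsResolutionOf (M.transform (p'' ≫ p) (C₁ * C₂)) ↔
      s.IsResolutionOf ((M.transform p C₁).transform p'' (C₂.comap p)) :=
  isResolutionOf_iff_of_boundaryEquiv s _ _ (hp.transform_comp_of_disjoint_ideal hp'' hdisj M) rfl
    (hp.boundaryEquiv_transform_comp_of_disjoint hp'' hdisj M h₁ h₂)

end TwoSteps

end Literature.AlgebraicGeometry.Resolution

end
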